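import Mathlib
import HarnessLib
import Summits.Ventures.LatticeQCDFlow.Exactness.SphereLOFlowEffectiveActionConcentration
import Summits.Ventures.LatticeQCDFlow.Exactness.SphereIndependenceSamplerAcceptance

/-!
# The mean Metropolis acceptance of the independence sampler built from the exact leading-order trivializing flow is at least `exp(−(|Λ|D²/8 + D·√(|Λ|/8)))`, `D = (12κ²υ²/(d−1))·c²·e^{3|κ|υc/(d−1)}`: an acceptance deficit of order `c²√|Λ|`

HONEST FRAMING: exact (Metropolis-corrected) sampling algorithms for lattice gauge theory;
figures of merit are autocorrelation/cost numbers at stated couplings and volumes; no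
continuum-physics claim.

Venture `LatticeQCDFlow` (cell pub-lqcd), topic `Exactness`; FANOUT row 7 (`s0-cpn-null`: the
S0-D1 rung — 2D CP⁹, Lüscher's LO trivializing map inside HMC, Engel–Schaefer 2011).  NEW WORK of
the cell over this leg's `Exactness/SphereIndependenceSamplerAcceptance.lean` (the mean acceptance
in closed form and the floor `exp(−(a + √(v/2)))` from MGF/variance bounds of the log-weight) and
`Exactness/SphereLOFlowEffectiveActionConcentration.lean` (`Var_π̄(S_eff) ≤ |Λ|D²/4`,
`∫e^{t(S_eff − E S_eff)}dπ̄ ≤ e^{t²|Λ|D²/8}`); GEN-15's `Exactness/SphereFlowLiouvilleMeasure.lean`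
(`(Φ_{0→c})_*(π̄.tilted(−S_eff)) = π̄.tilted(−cS)`: the target in flowed coordinates is the Gibbs law);
nothing is cited as a fact.  Printed counterpart, NAMED ONLY: Albergo–Kanwar–Shanahan 2019 §II.

## Content (E–S action, `d ≥ 2`, no self-coupling, adjoint pairs, local weight `≤ υ`, `0 ≤ c ≤ |T| + 1`)

* **`exp_neg_le_meanAccept_loFlow`** — `acc ≥ exp(−(|Λ|·D²/8 + D·√(|Λ|/8)))`;
* **`one_sub_le_meanAccept_loFlow`** — `acc ≥ 1 − |Λ|·D²/8 − D·√(|Λ|/8)`: the acceptance deficit of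
  the flow-based independence sampler is at most of order `c²·√|Λ|` (per-site quality `c⁴`, the
  square-root-of-volume law of an extensive log-weight with bounded differences).

NOT CLAIMED: upper bounds on the acceptance (that is the acceptance–footprint law of the sequel
`SphereLOFlowAcceptanceFootprint`); autocorrelation times; the rung's HMC-inside-the-map algorithm
or its numbers.
-/

noncomputable section

namespace Summit.Ventures.LatticeQCDFlow.Exactness

open Function Set Metric MeasureTheory NormedSpace InnerProductSpace
open scoped RealInnerProductSpace Topology

section Acceptance

variable {Λ : Type*} {E : Type*} [NormedAddCommGroup E] [InnerProductSpace ℝ E]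
  [FiniteDimensional ℝ E] [Fintype Λ] [DecidableEq Λ] [MeasurableSpace E] [BorelSpace E] [Nontrivial E]

variable {U : Λ → Λ → (E →L[ℝ] E)} {T : ℝ}

/-- **THE MEAN ACCEPTANCE OF THE FLOW-BASED INDEPENDENCE SAMPLER BUILT FROM THE EXACT LO FLOW IS AT
LEAST `exp(−(|Λ|·D²/8 + D·√(|Λ|/8)))`**, `D = (12κ²υ²/(d−1))·c²·e^{3|κ|υc/(d−1)}` (E–S action,
`d ≥ 2`, no self-coupling, adjoint pairs, local weight `≤ υ`, `0 ≤ c ≤ |T| + 1`; target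
`π̄.tilted(−S_eff)` whose image under `Φ_{0→c}` is `e^{−cS}π̄/Z_c`, proposal `π̄`). -/
theorem exp_neg_le_meanAccept_loFlow (hU0 : ∀ n, U n n = 0)
    (hUadj : ∀ m n (v w : E), ⟪U m n v, w⟫ = ⟪v, U n m w⟫) (hd : 2 ≤ Module.finrank ℝ E)
    (κ S₀ : ℝ) {υ : ℝ} (hυ : ∀ k, ∑ m, ‖U k m‖ ≤ υ) {c : ℝ} (hc0 : 0 ≤ c) (hc : c ≤ |T| + 1) :
    Real.exp (-(Fintype.card Λ * (12 * κ ^ 2 * υ ^ 2 / ((Module.finrank ℝ E : ℝ) - 1) * c ^ 2 *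
          Real.exp (3 * |κ| * υ / ((Module.finrank ℝ E : ℝ) - 1) * c)) ^ 2 / 8 +
        (12 * κ ^ 2 * υ ^ 2 / ((Module.finrank ℝ E : ℝ) - 1) * c ^ 2 *
          Real.exp (3 * |κ| * υ / ((Module.finrank ℝ E : ℝ) - 1) * c)) *
          Real.sqrt (Fintype.card Λ / 8))) ≤
      ∫ ω, (∫ ω', min 1 (Real.exp
          ((c * esAction κ S₀ U (sphereTDFlow (G := fun _ : ℝ => loFlowAction κ S₀ U)
              (contDiff_const_family (contDiff_loFlowAction U κ S₀)) T 0 c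
                (fun m => ((ω : Λ → sphere (0 : E) 1) m : E))) -
            sphereTDFlowLogJac (G := fun _ : ℝ => loFlowAction κ S₀ U)
              (contDiff_const_family (contDiff_loFlowAction U κ S₀)) T 0 c (fun m => (ω m : E))) -
          (c * esAction κ S₀ U (sphereTDFlow (G := fun _ : ℝ => loFlowAction κ S₀ U)
              (contDiff_const_family (contDiff_loFlowAction U κ S₀)) T 0 c
                (fun m => ((ω' : Λ → sphere (0 : E) 1) m : E))) -
            sphereTDFlowLogJac (G := fun _ : ℝ => loFlowAction κ S₀ U)
              (contDiff_const_family (contDiff_loFlowAction U κ S₀)) T 0 c (fun m => (ω' m : E)))))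
          ∂Measure.pi (fun _ : Λ => uniformSphere (volume : Measure E)))
        ∂(Measure.pi (fun _ : Λ => uniformSphere (volume : Measure E))).tilted (fun ω =>
          -(c * esAction κ S₀ U (sphereTDFlow (G := fun _ : ℝ => loFlowAction κ S₀ U)
              (contDiff_const_family (contDiff_loFlowAction U κ S₀)) T 0 c (fun m => (ω m : E))) -
            sphereTDFlowLogJac (G := fun _ : ℝ => loFlowAction κ S₀ U)
              (contDiff_const_family (contDiff_loFlowAction U κ S₀)) T 0 c (fun m => (ω m : E)))) := by
  have hd1 : 0 < (Module.finrank ℝ E : ℝ) - 1 := by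
    have : (2 : ℝ) ≤ Module.finrank ℝ E := by exact_mod_cast hd
    linarith
  have hmgf := integral_exp_mul_effAction_loFlow_sub_le hU0 hUadj hd κ S₀ hυ hc0 hc (-1) (T := T)
  have hvar := variance_effAction_loFlow_le hU0 hUadj hd κ S₀ hυ hc0 hc (T := T)
  set D : ℝ := 12 * κ ^ 2 * υ ^ 2 / ((Module.finrank ℝ E : ℝ) - 1) * c ^ 2 *
    Real.exp (3 * |κ| * υ / ((Module.finrank ℝ E : ℝ) - 1) * c) with hD
  have hD0 : 0 ≤ D := mul_nonneg (mul_nonneg (div_nonneg (by positivity) hd1.le) (sq_nonneg c))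
    (Real.exp_pos _).le
  have ha : (-1 : ℝ) ^ 2 * (Fintype.card Λ * D ^ 2) / 8 = Fintype.card Λ * D ^ 2 / 8 := by ring
  simp only [neg_one_mul] at hmgf
  rw [ha] at hmgf
  have h := exp_neg_le_meanAccept_of_mgf_of_variance
    (continuous_effAction_loFlow (U := U) κ S₀ c (T := T)) hmgf hvar
  have hsqrt : Real.sqrt (Fintype.card Λ * D ^ 2 / 4 / 2) = D * Real.sqrt (Fintype.card Λ / 8) := by
    rw [show (Fintype.card Λ : ℝ) * D ^ 2 / 4 / 2 = D ^ 2 * (Fintype.card Λ / 8) by ring,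
      Real.sqrt_mul (sq_nonneg D), Real.sqrt_sq hD0]
  rw [hsqrt] at h
  exact h

/-- **Corollary**: the acceptance deficit is at most `|Λ|·D²/8 + D·√(|Λ|/8)` (`e^{−x} ≥ 1 − x`): of
order `c²·√|Λ|` for small `c²√|Λ|`. -/
theorem one_sub_le_meanAccept_loFlow (hU0 : ∀ n, U n n = 0)
    (hUadj : ∀ m n (v w : E), ⟪U m n v, w⟫ = ⟪v, U n m w⟫) (hd : 2 ≤ Module.finrank ℝ E)
    (κ S₀ : ℝ) {υ : ℝ} (hυ : ∀ k, ∑ m, ‖U k m‖ ≤ υ) {c : ℝ} (hc0 : 0 ≤ c) (hc : c ≤ |T| + 1) :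
    1 - (Fintype.card Λ * (12 * κ ^ 2 * υ ^ 2 / ((Module.finrank ℝ E : ℝ) - 1) * c ^ 2 *
          Real.exp (3 * |κ| * υ / ((Module.finrank ℝ E : ℝ) - 1) * c)) ^ 2 / 8 +
        (12 * κ ^ 2 * υ ^ 2 / ((Module.finrank ℝ E : ℝ) - 1) * c ^ 2 *
          Real.exp (3 * |κ| * υ / ((Module.finrank ℝ E : ℝ) - 1) * c)) *
          Real.sqrt (Fintype.card Λ / 8)) ≤
      ∫ ω, (∫ ω', min 1 (Real.exp
          ((c * esAction κ S₀ U (sphereTDFlow (G := fun _ : ℝ => loFlowAction κ S₀ U)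
              (contDiff_const_family (contDiff_loFlowAction U κ S₀)) T 0 c
                (fun m => ((ω : Λ → sphere (0 : E) 1) m : E))) -
            sphereTDFlowLogJac (G := fun _ : ℝ => loFlowAction κ S₀ U)
              (contDiff_const_family (contDiff_loFlowAction U κ S₀)) T 0 c (fun m => (ω m : E))) -
          (c * esAction κ S₀ U (sphereTDFlow (G := fun _ : ℝ => loFlowAction κ S₀ U)
              (contDiff_const_family (contDiff_loFlowAction U κ S₀)) T 0 c
                (fun m => ((ω' : Λ → sphere (0 : E) 1) m : E))) -
            sphereTDFlowLogJac (G := fun _ : ℝ => loFlowAction κ S₀ U)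
              (contDiff_const_family (contDiff_loFlowAction U κ S₀)) T 0 c (fun m => (ω' m : E)))))
          ∂Measure.pi (fun _ : Λ => uniformSphere (volume : Measure E)))
        ∂(Measure.pi (fun _ : Λ => uniformSphere (volume : Measure E))).tilted (fun ω =>
          -(c * esAction κ S₀ U (sphereTDFlow (G := fun _ : ℝ => loFlowAction κ S₀ U)
              (contDiff_const_family (contDiff_loFlowAction U κ S₀)) T 0 c (fun m => (ω m : E))) -
            sphereTDFlowLogJac (G := fun _ : ℝ => loFlowAction κ S₀ U)
              (contDiff_const_family (contDiff_loFlowAction U κ S₀)) T 0 c (fun m => (ω m : E)))) := by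
  refine le_trans ?_ (exp_neg_le_meanAccept_loFlow hU0 hUadj hd κ S₀ hυ hc0 hc (T := T))
  have h := Real.add_one_le_exp (-(Fintype.card Λ * (12 * κ ^ 2 * υ ^ 2 /
      ((Module.finrank ℝ E : ℝ) - 1) * c ^ 2 *
        Real.exp (3 * |κ| * υ / ((Module.finrank ℝ E : ℝ) - 1) * c)) ^ 2 / 8 +
      (12 * κ ^ 2 * υ ^ 2 / ((Module.finrank ℝ E : ℝ) - 1) * c ^ 2 *
        Real.exp (3 * |κ| * υ / ((Module.finrank ℝ E : ℝ) - 1) * c)) * Real.sqrt (Fintype.card Λ / 8)))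
  linarith

end Acceptance

end Summit.Ventures.LatticeQCDFlow.Exactness

end
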